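import Summits.ResolutionOfSingularities.ResolutionOfSingularities.Theorems.HilbertSamuelEliminationSigmaMaxModificationsCorridor3WLadderMovingIsoDefs
import Summits.ResolutionOfSingularities.ResolutionOfSingularities.Theorems.HilbertSamuelEliminationCampaignW42OracleLocal
import HarnessLib

/-!
# [OURS · L1 W4.2] MODULE `Corridor3WLadderIsoRestart` — part 1/2: the DEFINITION of the run-level Zariski localisation row
# `LocalRunSimulationM` (crux chain w42, W4.2 DEAL D8 «ISO-RESTART AT LOCAL ORACLES», hand res-D-pv-060)

OURS (cell `res-hironaka`, slot W4.2, crux `stmt-ResolutionOfSingularities-18506` / conjunct `-19249`, skeleton `w_ladder` v6,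
idea-2's card G `iso-recurrence-core`, row `IdeasL1Idea2R4.IsoOpenRestartM` of `…Corridor3WLadderMovingIsoDefs` l.206); NOT a statement
of the manuscript under review in the cell [claim: Hironaka2017, status: under-review] nor of [CossartJannsenSaito2020] (cited only as a
POINTER for the analogy with Thm. 1.2's functoriality); asserts nothing; consumed only as a hypothesis BY NAME. AI typing, weaker than
expert review.

## Why this row exists (res-D-pv-060 PACE/CUT 2026-08-27T08:00:25Z, HONEST SIZE FINDING)

The restart row `IsoOpenRestartM 𝓞 p` (at a reachable ISOLATED stage `s` of a moving E3 chain, the chain continues as a moving E3 chain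
of the run of a POINTED maximal origin `(U, x_s)`, `U(ν) = {x_s}`) is meant for LOCAL oracles `𝓞 = OracleLocal` (res-type-082,
`…CampaignW42OracleLocal`). Its content is a SIMULATION of the LABELLED canonical-step machine (`Labelling.next`, `Pending`,
`IsReplayStep`, `IsCanonicalStep`, `CanonicalNearStep`) under restriction to an open: the run of `(U, x_s)` from `MarkedStage.init`
(fresh labels, no pending cycle) follows the tail of the global run OVER `U` — the `U`-years differ from the global years (global steps
idle over `U` still advance the year) and correspond only through a monotone re-indexing of birth years, order-isomorphic on the
components meeting `U`; global cycles on label parts disjoint from `U` are idle over `U` and are skipped; a `U`-cycle replays the pruned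
restriction `(t|_U).prune` of the global replay sequence `t` — EXACTLY what `OracleLocal` supplies —; the chosen blow-ups agree over `U`
(`blowup (C|_U) ≅ (blowup C)|_U`, and `≅` across the idle steps, blow-ups being isomorphisms off their centres). It holds because
`U(ν) = {x_s}` is ONE component (several old components of different ages would be merged into one label-`0` cycle by the fresh run).
The tree has the sequence-level restriction `CentreSeq.restrict` / `.prune` (F-res2″ infrastructure) but NO restriction lemma for the
labelled machine; the simulation is therefore typed HERE as a row (idea-2 M-class «only mis-typing can fail»; honest size of its PROOF:
XL) and the restart is PROVED from it in part 2/2 (`isoOpenRestartM_oracleLocal_of_simulation`).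

## The row

`LocalRunSimulationM p`: for every functional admissible LOCAL oracle `R`, every maximal origin `(X, x)` of characteristic `p` at level
`3` and value `ν`, every infinite chain `c` of canonical near steps from a stage `c 0` reached from `(X, x)`, blown up at the marked point
infinitely often, and every open `U ⊆ X_{c 0}` around the marked point with `U(ν) = {x_{c 0}}` (pointed), there are
* a chain `c'` of canonical near steps from `MarkedStage.init U x_{c 0}` (the run of the pointed origin),
* a re-indexing `ψ : ℕ → ℕ` with `ψ 0 = 0`, non-decreasing by steps `0 / 1`,
* for every global index `m` an OPEN IMMERSION `ι m : (c' (ψ m)).W ⟶ (c m).W` carrying marked point to marked point,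
such that every GENUINE global step (the marked point is blown up) is a genuine `U`-step: `ψ (m+1) = ψ m + 1` and the marked point of
`c' (ψ m)` is blown up. (Isolation of `c 0` is not even needed for the statement; it is where the row is USED.) [folklore]
-/

set_option linter.dupNamespace false

open CategoryTheory AlgebraicGeometry TopologicalSpace
open Summit.ResolutionOfSingularities.ResolutionOfSingularities.Theorems.CampaignW42
open Literature.AlgebraicGeometry.Resolution Literature.RingTheory.HilbertSamuel
open Summit.ResolutionOfSingularities.ResolutionOfSingularities.Theorems.SigmaMaxModificationsCorridor3
open Summit.ResolutionOfSingularities.ResolutionOfSingularities.Theorems.SigmaMaxModificationsCorridor3.Moving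
open Summit.ResolutionOfSingularities.ResolutionOfSingularities.Theorems.SigmaMaxModificationsCorridor3.Helpers (QPointed)

namespace Summit.ResolutionOfSingularities.ResolutionOfSingularities.Cruxes.SigmaMaxModifications.IdeasL1Idea2R4

universe u

/-- [OURS · L1 W4.2] **RUN-LEVEL ZARISKI LOCALISATION FOR LOCAL ORACLES (the simulation behind the restart row).** For a functional,
admissible, LOCAL oracle `R` (`OracleLocal`, CJS Thm. 1.2's compatibility with Zariski localisation asked of the oracle), a maximal
origin `(X, x)` of characteristic `p` at level `3`, an infinite chain `c` of canonical near steps from a reached stage `c 0`, blown up at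
its marked point infinitely often, and an open `U` of the stage `X_{c 0}` around the marked point `x₀ := (c 0).pt` which is POINTED
(`U(ν) = {x₀}`): the run of `(U, x₀)` from `MarkedStage.init` SIMULATES the chain over `U` — a chain `c'` of canonical near steps from
`MarkedStage.init U x₀`, a re-indexing `ψ` (`ψ 0 = 0`, steps `0`/`1`), and open immersions `ι m : (c' (ψ m)).W ⟶ (c m).W` with
`ι m (c' (ψ m)).pt = (c m).pt`, every genuine global step being a genuine `U`-step (`ψ (m+1) = ψ m + 1`, `c' (ψ m)` blown up).
Why it might fail: only mis-typing of the labelled machine under restriction (labels re-indexed monotonically; idle global cycles skipped;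
`U`-cycles = pruned restrictions of global cycles by `OracleLocal`; chosen blow-ups agree over `U` up to isomorphism); it would FAIL for a
non-pointed `U` (old components of different ages merged by the fresh run) and for non-local oracles. Honest size of the proof: XL.
[cite: CossartJannsenSaito2020, Thm. 1.2 (p. 5), Rem. 6.29 (1)] -/
def LocalRunSimulationM (p : ℕ) : Prop :=
  ∀ (R : ∀ S : Scheme.{u}, CentreSeq S → Prop), OracleFunctional R → OracleAdmissible R → OracleLocal R →
  ∀ (ν : ℕ → ℕ) (X : Scheme.{u}) [IsLocallyNoetherian X] (x : X), IsMaximalOrigin p 3 ν X x →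
  ∀ c : ℕ → MarkedStage.{u}, Reaches R 3 ν (MarkedStage.init X x) (c 0) →
    (∀ n, CanonicalNearStep R 3 ν (c n) (c (n + 1))) → (∀ n, ∃ m, n ≤ m ∧ (c m).IsBlownUp R 3 ν) →
    ∀ (U : (c 0).W.Opens) (hU : IsLocallyNoetherian (U : Scheme.{u})) (h₀ : (c 0).pt ∈ U),
      QPointed 3 ν (U : Scheme.{u}) ⟨(c 0).pt, h₀⟩ →
      ∃ (c' : ℕ → MarkedStage.{u}) (ψ : ℕ → ℕ) (ι : ∀ m, (c' (ψ m)).W ⟶ (c m).W),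
        c' 0 = @MarkedStage.init (U : Scheme.{u}) hU ⟨(c 0).pt, h₀⟩ ∧ ψ 0 = 0 ∧
        (∀ k, CanonicalNearStep R 3 ν (c' k) (c' (k + 1))) ∧
        (∀ m, IsOpenImmersion (ι m) ∧ (ι m).base (c' (ψ m)).pt = (c m).pt) ∧
        (∀ m, ψ (m + 1) = ψ m ∨ ψ (m + 1) = ψ m + 1) ∧
        (∀ m, (c m).IsBlownUp R 3 ν → ψ (m + 1) = ψ m + 1 ∧ (c' (ψ m)).IsBlownUp R 3 ν)

end Summit.ResolutionOfSingularities.ResolutionOfSingularities.Cruxes.SigmaMaxModifications.IdeasL1Idea2R4
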